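import Literature.Probability.RandomPlanarGeometry.SAWWordBridges

/-!
# Crux `TubeLowerBound` (stmt-CriticalPhenomena-4730), line `subcritical-renewal-floor`:
# sub-goal `flipWord_spec` (the word flip `y ↦ -y` preserves irreducible bridges)

The reflection of `ℤ²` in the first axis, `(x, y) ↦ (x, -y)`, acts on step words `w : List Step`
(`Step = Fin 4`, `0 ↦ +e₀`, `1 ↦ +e₁`, `2 ↦ -e₀`, `3 ↦ -e₁`) letter by letter through the swap
`1 ↔ 3`, i.e. through `fun d : Step => if d = 1 then 3 else if d = 3 then 1 else d`.  We record the
combinatorial input of the sign-steering arguments on Kesten pieces: the flipped word has the same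
first-coordinate trajectory and the negated second-coordinate trajectory (`traj_map_flip`), the
flip is an involution (`map_flip_map_flip`), and it preserves self-avoidance (`IsSAW`, the
trajectory stays injective since `(x, y) ↦ (x, -y)` is injective), bridges (`IsBridgeW` only
mentions first coordinates and the length) and irreducible bridges (`IsIrrBridge`: break points
only mention first coordinates and the length, and the flip of a non-empty word is non-empty).
All statements keep the flip as the literal lambda (no new definition is introduced).
-/

namespace Summit.CriticalPhenomena.SAWScalingLimit.Theorems.TubeLowerBound.SubcriticalRenewalFloor

open scoped BigOperators Classical
open Literature.Probability.LatticeModels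
open Literature.Probability.RandomPlanarGeometry Literature.Probability.RandomPlanarGeometry.SAW

namespace FlipWord

/-! ### Step tables of the flip `1 ↔ 3` -/

/-- The flip fixes the first coordinate of every unit step. [folklore] -/
theorem dx_flip (d : Step) :
    Step.dx (if d = 1 then 3 else if d = 3 then 1 else d) = Step.dx d := by
  revert d; decide

/-- The flip negates the second coordinate of every unit step. [folklore] -/
theorem dy_flip (d : Step) :
    Step.dy (if d = 1 then 3 else if d = 3 then 1 else d) = -Step.dy d := by
  revert d; decide

/-- The flip is an involution on steps. [folklore] -/
theorem flip_flip (d : Step) :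
    (if (if d = 1 then (3 : Step) else if d = 3 then 1 else d) = 1 then (3 : Step)
      else if (if d = 1 then (3 : Step) else if d = 3 then 1 else d) = 3 then 1
      else if d = 1 then (3 : Step) else if d = 3 then 1 else d) = d := by
  revert d; decide

/-! ### Endpoints and trajectories -/

/-- The endpoint of the flipped word is the reflection `(x, y) ↦ (x, -y)` of the endpoint.
[folklore] -/
theorem wEnd_map_flip (u : List Step) :
    wEnd (u.map fun d : Step => if d = 1 then 3 else if d = 3 then 1 else d) 0 = wEnd u 0 ∧
      wEnd (u.map fun d : Step => if d = 1 then 3 else if d = 3 then 1 else d) 1 = -wEnd u 1 := by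
  induction u with
  | nil => simp
  | cons d u ih =>
    constructor
    · simp only [List.map_cons, wEnd_cons, Pi.add_apply, Step.vec_apply_zero, dx_flip, ih.1]
    · simp only [List.map_cons, wEnd_cons, Pi.add_apply, Step.vec_apply_one, dy_flip, ih.2,
        neg_add]

/-- The trajectory of the flipped word is the reflection `(x, y) ↦ (x, -y)` of the trajectory.
[folklore] -/
theorem traj_map_flip (w : List Step) (i : ℕ) :
    traj (w.map fun d : Step => if d = 1 then 3 else if d = 3 then 1 else d) i 0 = traj w i 0 ∧
      traj (w.map fun d : Step => if d = 1 then 3 else if d = 3 then 1 else d) i 1 = -traj w i 1 := by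
  rw [traj, traj, ← List.map_take]
  exact wEnd_map_flip (w.take i)

/-- The flip is an involution on words. [folklore] -/
theorem map_flip_map_flip (w : List Step) :
    (w.map fun d : Step => if d = 1 then 3 else if d = 3 then 1 else d).map
        (fun d : Step => if d = 1 then 3 else if d = 3 then 1 else d) = w := by
  induction w with
  | nil => rfl
  | cons d w ih => rw [List.map_cons, List.map_cons, ih, flip_flip]

/-- The first-coordinate process is unchanged by the flip. [folklore] -/
theorem xAt_map_flip (w : List Step) :
    xAt (w.map fun d : Step => if d = 1 then 3 else if d = 3 then 1 else d) = xAt w :=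
  funext fun i => (traj_map_flip w i).1

/-- The span is unchanged by the flip. [folklore] -/
theorem xEnd_map_flip (w : List Step) :
    xEnd (w.map fun d : Step => if d = 1 then 3 else if d = 3 then 1 else d) = xEnd w := by
  rw [xEnd, xEnd, xAt_map_flip, List.length_map]

/-! ### Self-avoidance, bridges, break points -/

/-- The flip of a self-avoiding word is self-avoiding. [folklore] -/
theorem isSAW_map_flip {w : List Step} (h : IsSAW w) :
    IsSAW (w.map fun d : Step => if d = 1 then 3 else if d = 3 then 1 else d) := by
  rw [isSAW_iff_injOn] at h ⊢
  intro i hi j hj hij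
  simp only [Set.mem_setOf_eq, List.length_map] at hi hj
  refine h hi hj (funext (Fin.forall_fin_two.2 ⟨?_, ?_⟩))
  · rw [← (traj_map_flip w i).1, ← (traj_map_flip w j).1, hij]
  · have h1 := congrFun hij 1
    rw [(traj_map_flip w i).2, (traj_map_flip w j).2] at h1
    exact neg_injective h1

/-- The flip of a bridge is a bridge. [folklore] -/
theorem isBridgeW_map_flip {w : List Step} (h : IsBridgeW w) :
    IsBridgeW (w.map fun d : Step => if d = 1 then 3 else if d = 3 then 1 else d) := by
  rw [isBridgeW_iff] at h ⊢
  rw [xAt_map_flip, xEnd_map_flip, List.length_map]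
  exact h

/-- Break points are unchanged by the flip. [folklore] -/
theorem isBreak_map_flip (w : List Step) (j : ℕ) :
    IsBreak (w.map fun d : Step => if d = 1 then 3 else if d = 3 then 1 else d) j ↔ IsBreak w j := by
  unfold IsBreak
  rw [xAt_map_flip, List.length_map]

/-- The flip of an irreducible word is irreducible. [folklore] -/
theorem isIrreducible_map_flip {w : List Step} (h : IsIrreducible w) :
    IsIrreducible (w.map fun d : Step => if d = 1 then 3 else if d = 3 then 1 else d) :=
  fun j hj => h j ((isBreak_map_flip w j).1 hj)

/-- The flip of an irreducible bridge is an irreducible bridge. [folklore] -/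
theorem isIrrBridge_map_flip {w : List Step} (h : IsIrrBridge w) :
    IsIrrBridge (w.map fun d : Step => if d = 1 then 3 else if d = 3 then 1 else d) :=
  ⟨isSAW_map_flip h.saw, isBridgeW_map_flip h.bridge, isIrreducible_map_flip h.irr,
    fun h0 => h.ne_nil (List.map_eq_nil_iff.1 h0)⟩

end FlipWord

/-- **The word flip `y ↦ -y`.**  For the letterwise swap `1 ↔ 3` of a step word `w` (the
reflection `(x, y) ↦ (x, -y)` of `ℤ²` read on words): the first-coordinate trajectory is
unchanged and the second is negated; the flip is an involution; and it preserves self-avoiding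
words, bridges and irreducible bridges. [folklore] -/
theorem flipWord_spec :
    ∀ w : List Step, (∀ i, traj (w.map (fun d : Step => if d = 1 then 3 else if d = 3 then 1 else d)) i 0 = traj w i 0 ∧ traj (w.map (fun d : Step => if d = 1 then 3 else if d = 3 then 1 else d)) i 1 = - traj w i 1) ∧ (w.map (fun d : Step => if d = 1 then 3 else if d = 3 then 1 else d)).map (fun d : Step => if d = 1 then 3 else if d = 3 then 1 else d) = w ∧ (IsSAW w → IsSAW (w.map (fun d : Step => if d = 1 then 3 else if d = 3 then 1 else d))) ∧ (IsBridgeW w → IsBridgeW (w.map (fun d : Step => if d = 1 then 3 else if d = 3 then 1 else d))) ∧ (IsIrrBridge w → IsIrrBridge (w.map (fun d : Step => if d = 1 then 3 else if d = 3 then 1 else d))) :=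
  fun w => ⟨FlipWord.traj_map_flip w, FlipWord.map_flip_map_flip w, FlipWord.isSAW_map_flip,
    FlipWord.isBridgeW_map_flip, FlipWord.isIrrBridge_map_flip⟩

end Summit.CriticalPhenomena.SAWScalingLimit.Theorems.TubeLowerBound.SubcriticalRenewalFloor
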